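/-
Copyright (c) 2026. All rights reserved.
Released under Apache 2.0 license as described in the file LICENSE.
Authors: abc-iut cell, seat abc-iut-L4-t14 (gen 2; GAP row G-w5d226-1 at the holomorphic geometric model —
the typer lineage of [AbsTopIII] §2 remarks / Def 4.1, `HolomorphicCores`, `ArchimedeanLogFrobenius`).
-/
import Literature.AnabelianGeometry.AbsoluteAnabelian.ArchimedeanHolMonoidPairsLogFrobenius
import Literature.AnabelianGeometry.AbsoluteAnabelian.AbsTopIII.AutHolLogFrobeniusModelProofs
import Literature.AnabelianGeometry.AbsoluteAnabelian.AutHolomorphicSpacesFiniteEtaleProofs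
import Literature.AnabelianGeometry.AbsoluteAnabelian.HolomorphicCoresLocalLinearProofs
import Literature.AnabelianGeometry.AbsoluteAnabelian.HolomorphicCoresDeckProofs
import Mathlib.Geometry.Manifold.MFDeriv.Basic
import Mathlib.CategoryTheory.ObjectProperty.FullSubcategory
import HarnessLib

/-!
# [AbsTopIII] Def 4.1 (i)/(iii): the interface `AutHolFieldFunctor` (Cor 2.7 (e) + functoriality)
# instantiated on geometric carriers — connected Riemann surfaces, holomorphic finite étale maps,
# `𝒜_𝕏 = ℂ` the multiplier field of the germ model

S. Mochizuki, *Topics in absolute anabelian geometry III*, Def 4.1 (i) p. 101 ("`𝒜_𝕏_ell := 𝒜_𝕏_ell ∪ {0}`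
— where we write `𝒜_𝕏_ell` for the '`𝒜_p`' of Corollary 2.7, (e) …, which may be identified [hence
considered as an object that is independent of '`p`'] via the various isomorphisms '`𝒜_p ⥲ 𝒜_{p'}`' of
Corollary 2.7, (e), together with the functoriality of the algorithms of Corollary 2.7"), Def 4.1 (iii)
p. 103 ("`TH ⊇ EA ⊇ EA_sB` … the subcategories determined, respectively, by the elliptically admissible
hyperbolic orbicurves over CAF's and the finite étale morphisms …"), Cor 2.7 (e) p. 60, Prop 2.6 (a)
p. 57; kurims manuscript, lit key `paper:url-5493eb38cbb7`, read on the page; bib key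
`MochizukiAbsTopIII2015`.

abc-iut-L4-t10's MODEL of §4 (`ArchimedeanHolCategories` / `ArchimedeanHolPairs` /
`ArchimedeanLogFrobeniusModel` / `AbsTopIII.AutHolLogFrobeniusModelProofs`) and abc-iut-w5-d226's monoid
types (`ArchimedeanHolMonoidPairs*`) are written over ONE abstract structure `𝔄 : AutHolFieldFunctor` —
the category `EA`, the CAF `𝒜_𝕏` for each object and the induced isomorphisms `𝒜_φ` along finite étale
morphisms, functorially — whose instantiation "on the tree's concrete carriers IS the construction of
the Cor 2.7 algorithms and is not done here" (t10), recorded as GAP row G-w5d226-1.  This file gives the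
instantiation at the HOLOMORPHIC GEOMETRIC MODEL:

* `HolRS`: connected Hausdorff Riemann surfaces (a type charted over `ℂ` with `IsManifold 𝓘(ℂ, ℂ) ω`; the
  structure-orbispaces of Def 4.1 with trivial orbi-group — abc-iut-L4-t2's `AutHolOrbiPresentation.ofSpace`),
  made a category with morphisms the HOLOMORPHIC FINITE ÉTALE maps (`MDifferentiable` and abc-iut-L4-t2's
  `IsFiniteEtale` = covering map with finite fibres; identities and composites by
  `IsFiniteEtale.id` / `IsFiniteEtale.comp`, Rmk 2.3.3) — `HolRS.category`;
* `geometricAutHolFieldFunctor Q : AutHolFieldFunctor`: `EA := ` the full subcategory of `HolRS` cut out by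
  an ARBITRARY object property `Q` (print's "elliptically admissible hyperbolic orbicurves over CAF's" is
  a PARAMETER here, exactly as the strictly-Belyi predicate is in abc-iut-w5-d226's `sB` clause),
  `𝒜_𝕏 := ℂ` and `𝒜_φ := id`.  JUSTIFICATION (the germ model, abc-iut-w4-d104): by Prop 2.6 (a) at the germ
  model, `𝒜_p ≅ ℂˣ` canonically (`germAutIsoUnits p : ℂˣ ≃ₜ* germAut p`, p412533 — re-exported below as
  `HolRS.unitsMultiplierIso`), the isomorphisms `𝒜_p ⥲ 𝒜_{p'}` are "same multiplier" (`germAutTrans`,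
  `germAutIsoUnits_trans`), and along a HOLOMORPHIC local isomorphism `φ` the induced map on multipliers is
  the IDENTITY (`hasDerivAt_conj_mulAffine`, p420903: the multiplier of an `𝒜_p`-germ is invariant under
  every holomorphic change of coordinates, while literal conjugation of germs does NOT preserve `𝒜_p`,
  `germ_conj_not_mem_germAut`) — GAP-LEDGER row D-G-w5d226-1.  So on holomorphic morphisms the honest
  functoriality datum is `RingEquiv.refl ℂ`;
* consequences: `EA` is NONEMPTY as soon as `Q` admits an object (`ℂ` and every connected open subset of
  `ℂ` are objects of `HolRS`: `HolRS.complexPlane`, `HolRS.ofOpen`); the `TF`- and `T`-pairs `(𝕏 ↶ ℂ)` over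
  geometric `𝕏` exist (`HolRS.tfPair`, `HolRS.monoidPair`); and abc-iut-L4-t10's `AbsTopIII.cor_4_5_arch` /
  abc-iut-w5-d226's Prop 4.2 (i) theorems SPECIALISE to geometric carriers (`HolRS.cor_4_5_geometric`,
  `HolRS.prop_4_2_i_geometric`, `HolRS.isIdRigid_pairs_of_isIdRigid_EA`), so that the residual of the
  nodes AbsTopIII:Cor4.5 / Prop4.2 at the model becomes the single hypothesis `IsIdRigid EA^hol_RS(Q)`
  (print: ⇐ Lemma 4.3 slimness + Cor 2.3 (i) + Riemann existence; campaign-L), stated over real Riemann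
  surfaces.

* every morphism of `HolRS` IS a morphism of the Aut-holomorphic spaces of Def 2.1 (ii) (abc-iut-L4-t2's
  `IsMorphism (AutHolStructure.ofCharted 𝕏) (AutHolStructure.ofCharted 𝕐) φ`: it transports `Aut^hol(U)`
  onto `Aut^hol(V)` along every induced homeomorphism of connected opens) — `HolRS.Hom.isMorphism`, via
  the holomorphic inverse function theorem on Riemann surfaces (`mdifferentiableAt_symm_of_mdifferentiable`)
  — so `HolRS` is an honest subcategory of print's `TH`.

MODELLING CHOICES (honest scope).  (a) Print's `TH`/`EA` morphisms are the morphisms of Aut-holomorphic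
orbispaces, which are RC-holomorphic (Cor 2.3 (i)): the ANTI-holomorphic finite étale maps — on which
`𝒜_φ` is complex conjugation — are NOT morphisms of `HolRS` (TODO(general form): needs the
`IsHolAt`/`IsAntiHolAt` composition parities for local homeomorphisms; the tree has them for
homeomorphisms only, `AutHolomorphicSpacesHolTypeProofs`); `HolRS` is the orientation-preserving
(co-oriented) part of `TH` restricted to Riemann surfaces.  (b) The ORBI case — orbi-objects `[𝕌/Γ]` with
nontrivial `Γ` — is NOT constructed.  (c) `𝒜_𝕏` is TAKEN to be the multiplier field `ℂ` of the germ model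
rather than re-derived as a field of germ sections; the bridge is the pair of cited theorems of
abc-iut-w4-d104 (`germAutIsoUnits`, `hasDerivAt_conj_mulAffine`).  (d) The ALGORITHMIC CONTENT of Cor 2.7
(reconstruction of `𝒜_p`, of the local additive structures, of the field structure from the
Aut-holomorphic structure alone) is NOT constructed: this is a MODEL (the intended interpretation of the
interface), not a discharge of Cor 2.7; `Q` (admissibility) stays a parameter; the one remaining
hypothesis of the model theorems, `IsIdRigid EA`, is not proved.  Refereed pre-IUT anabelian geometry;
nothing here bears on [IUTchIII] Cor. 3.12 or takes a side; typed ≠ discharged; model ≠ reconstruction.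
-/

set_option autoImplicit false

noncomputable section

namespace Literature.AnabelianGeometry.AbsoluteAnabelian

open _root_.CategoryTheory _root_.Topology _root_.TopologicalSpace
open scoped _root_.Manifold _root_.ContDiff

/-! ### Connected Riemann surfaces and holomorphic finite étale maps -/

/-- **A connected Riemann surface** — the structure-orbispace `𝕏` of an object of `TH`/`EA` with trivial
orbi-group: a Hausdorff, connected type charted over `ℂ` with holomorphic (`C^ω`) transition maps
("connected Aut-holomorphic orbispaces", Def 4.1 (i) p.101; Riemann surfaces as Aut-holomorphic spaces,
Def 2.1 (i), Rmk 2.1.1). [cite: MochizukiAbsTopIII2015, Definition 4.1 (i) p.101] -/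
structure HolRS : Type 1 where
  /-- the underlying type of the Riemann surface -/
  carrier : Type
  [topologicalSpace : TopologicalSpace carrier]
  [t2Space : T2Space carrier]
  [connectedSpace : ConnectedSpace carrier]
  [chartedSpace : ChartedSpace ℂ carrier]
  [isManifold : IsManifold 𝓘(ℂ, ℂ) ω carrier]

attribute [instance] HolRS.topologicalSpace HolRS.t2Space HolRS.connectedSpace HolRS.chartedSpace
  HolRS.isManifold

namespace HolRS

/-- **A holomorphic finite étale map** of connected Riemann surfaces `𝕏 → 𝕐`: a `ℂ`-differentiable map
of the charted spaces which is finite étale in the sense of Def 2.1 (ii) (abc-iut-L4-t2's `IsFiniteEtale`: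
a covering map with finite fibres) — "the finite étale morphisms" of Def 4.1 (iii), holomorphic half (see
the module docstring, scope (a)). [cite: MochizukiAbsTopIII2015, Definition 4.1 (iii) p.103] -/
@[ext]
structure Hom (X Y : HolRS) : Type 1 where
  /-- the underlying map -/
  toFun : X.carrier → Y.carrier
  /-- holomorphic -/
  mdifferentiable : MDifferentiable 𝓘(ℂ, ℂ) 𝓘(ℂ, ℂ) toFun
  /-- finite étale (covering map with finite fibres) -/
  isFiniteEtale : IsFiniteEtale toFun

/-- The identity is a holomorphic finite étale map. [cite: MochizukiAbsTopIII2015, Remark 2.3.3 p.54] -/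
protected def Hom.id (X : HolRS) : Hom X X where
  toFun := _root_.id
  mdifferentiable := mdifferentiable_id
  isFiniteEtale := IsFiniteEtale.id

/-- Composites of holomorphic finite étale maps are holomorphic finite étale ("any composite of
morphisms of Aut-holomorphic spaces is again a morphism", Rmk 2.3.3; `IsFiniteEtale.comp` for a Hausdorff
source, `MDifferentiable.comp`). [cite: MochizukiAbsTopIII2015, Remark 2.3.3 p.54] -/
protected def Hom.comp {X Y Z : HolRS} (f : Hom X Y) (g : Hom Y Z) : Hom X Z where
  toFun := g.toFun ∘ f.toFun
  mdifferentiable := g.mdifferentiable.comp f.mdifferentiable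
  isFiniteEtale := g.isFiniteEtale.comp f.isFiniteEtale

/-- **Connected Riemann surfaces with holomorphic finite étale maps form a category** (the holomorphic
part of `TH` restricted to Riemann surfaces, Def 4.1 (iii)). [cite: MochizukiAbsTopIII2015, Definition 4.1 (iii) p.103] -/
instance category : Category.{1} HolRS where
  Hom := Hom
  id := Hom.id
  comp := Hom.comp
  id_comp _ := rfl
  comp_id _ := rfl
  assoc _ _ _ := rfl

/-- The underlying map of an identity. [cite: MochizukiAbsTopIII2015, Definition 4.1 (iii) p.103] -/
@[simp] theorem id_toFun (X : HolRS) : (𝟙 X : Hom X X).toFun = _root_.id := rfl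

/-- The underlying map of a composite. [cite: MochizukiAbsTopIII2015, Definition 4.1 (iii) p.103] -/
@[simp] theorem comp_toFun {X Y Z : HolRS} (f : X ⟶ Y) (g : Y ⟶ Z) :
    (f ≫ g).toFun = g.toFun ∘ f.toFun := rfl

/-- Two morphisms with the same underlying map are equal. [cite: MochizukiAbsTopIII2015, Definition 4.1 (iii) p.103] -/
theorem hom_ext {X Y : HolRS} {f g : X ⟶ Y} (h : f.toFun = g.toFun) : f = g := Hom.ext h

/-- A morphism of `HolRS` is holomorphic at every point in abc-iut-L4-t2's sense `IsHolAt`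
(Def 2.1 (ii) vocabulary). [cite: MochizukiAbsTopIII2015, Definition 2.1 (ii) p.51] -/
theorem Hom.isHolAt {X Y : HolRS} (f : X ⟶ Y) (x : X.carrier) : IsHolAt f.toFun x :=
  Filter.Eventually.of_forall fun y => f.mdifferentiable y

/-- A morphism of `HolRS` is a local homeomorphism. [cite: MochizukiAbsTopIII2015, Definition 2.1 (ii) p.51] -/
theorem Hom.isLocalHomeomorph {X Y : HolRS} (f : X ⟶ Y) : IsLocalHomeomorph f.toFun :=
  f.isFiniteEtale.isCoveringMap.isLocalHomeomorph

/-! ### Every morphism of `HolRS` is a morphism of Aut-holomorphic spaces (Def 2.1 (ii)) -/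

section IsMorphism

variable {M : Type} [TopologicalSpace M] [ChartedSpace ℂ M] [IsManifold 𝓘(ℂ, ℂ) ω M]
  {N : Type} [TopologicalSpace N] [ChartedSpace ℂ N] [IsManifold 𝓘(ℂ, ℂ) ω N]

omit [IsManifold 𝓘(ℂ, ℂ) ω M] [IsManifold 𝓘(ℂ, ℂ) ω N] in
/-- Transport of `Aut^hol` by conjugation along a homeomorphism `e : U ≃ₜ V` of open subsets of two
Riemann surfaces, holomorphic in both directions (two-surface form of the lineage's
`holAut_map_homeoConj_of_restrict`). [cite: MochizukiAbsTopIII2015, Definition 2.1 (ii) p.51] -/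
theorem holAut_map_homeoConj_of_mdifferentiable {U : Opens M} {V : Opens N} (e : U ≃ₜ V)
    (hme : MDifferentiable 𝓘(ℂ, ℂ) 𝓘(ℂ, ℂ) e) (hme' : MDifferentiable 𝓘(ℂ, ℂ) 𝓘(ℂ, ℂ) e.symm) :
    (holAut U).map (homeoConj e).toMonoidHom = holAut V := by
  ext χ
  rw [Subgroup.mem_map_equiv]
  simp only [mem_holAut_iff]
  constructor
  · rintro ⟨h1, h2⟩
    refine ⟨?_, ?_⟩
    · have : ⇑χ = e ∘ ((homeoConj e).symm χ) ∘ e.symm := by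
        ext y; simp [homeoConj]
      rw [this]; exact (hme.comp h1).comp hme'
    · have : ⇑χ.symm = e ∘ ((homeoConj e).symm χ).symm ∘ e.symm := by
        ext y; simp [homeoConj]
      rw [this]; exact (hme.comp h2).comp hme'
  · rintro ⟨h1, h2⟩
    refine ⟨?_, ?_⟩
    · have : ⇑((homeoConj e).symm χ) = e.symm ∘ χ ∘ e := by
        ext y; simp [homeoConj]
      rw [this]; exact (hme'.comp h1).comp hme
    · have : ⇑((homeoConj e).symm χ).symm = e.symm ∘ χ.symm ∘ e := by
        ext y; simp [homeoConj]
      rw [this]; exact (hme'.comp h2).comp hme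

omit [IsManifold 𝓘(ℂ, ℂ) ω M] [IsManifold 𝓘(ℂ, ℂ) ω N] in
/-- The restriction `e : U → V` of a holomorphic map `f : M → N` to open subsets is holomorphic.
[cite: MochizukiAbsTopIII2015, Definition 2.1 (ii) p.51] -/
theorem mdifferentiable_opens_of_val_eq' {U : Opens M} {V : Opens N} {f : M → N}
    (hf : MDifferentiable 𝓘(ℂ, ℂ) 𝓘(ℂ, ℂ) f) (e : U → V) (he : ∀ x : U, (e x : N) = f x) :
    MDifferentiable 𝓘(ℂ, ℂ) 𝓘(ℂ, ℂ) e := by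
  intro x
  rw [← mdifferentiableAt_subtypeVal_comp_iff]
  have : (Subtype.val ∘ e) = fun x : U => f x := funext fun x => he x
  rw [this, mdifferentiableAt_subtype_iff]
  exact hf x

/-- **Holomorphic inverse function theorem, restricted form**: if the homeomorphism `e : U ≃ₜ V` of open
subsets is the restriction of a holomorphic local homeomorphism `f : M → N` of Riemann surfaces, then
`e⁻¹` is holomorphic. [cite: FritzscheGrauert2002, Ch. I §8 Cor. 8.6] -/
theorem mdifferentiable_symm_of_val_eq {U : Opens M} {V : Opens N} {f : M → N}
    (hf : MDifferentiable 𝓘(ℂ, ℂ) 𝓘(ℂ, ℂ) f) (hfl : IsLocalHomeomorph f) (e : U ≃ₜ V)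
    (he : ∀ x : U, (e x : N) = f x) : MDifferentiable 𝓘(ℂ, ℂ) 𝓘(ℂ, ℂ) e.symm := by
  intro y
  obtain ⟨h, hxs, hfh⟩ := hfl (e.symm y : M)
  have hyx : (y : N) = f (e.symm y : M) := by rw [← he, e.apply_symm_apply]
  have hyt : (y : N) ∈ h.target := by
    rw [hyx, hfh]; exact h.map_source hxs
  have hsymm : MDifferentiableAt 𝓘(ℂ, ℂ) 𝓘(ℂ, ℂ) h.symm (y : N) :=
    mdifferentiableAt_symm_of_mdifferentiable h (fun u _ => by rw [← hfh]; exact hf u) hyt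
  -- near `y`, `e⁻¹` followed by the inclusion agrees with `h⁻¹`
  have hev : (Subtype.val ∘ e.symm) =ᶠ[𝓝 y] (fun y' : V => h.symm (y' : N)) := by
    have hcont : Continuous fun y' : V => (e.symm y' : M) :=
      continuous_subtype_val.comp e.symm.continuous
    have hnear : ∀ᶠ y' in 𝓝 y, (e.symm y' : M) ∈ h.source :=
      hcont.continuousAt.preimage_mem_nhds (h.open_source.mem_nhds hxs)
    filter_upwards [hnear] with y' hy'
    have hval : h (e.symm y' : M) = (y' : N) := by rw [← hfh, ← he, e.apply_symm_apply]
    simp only [Function.comp_apply]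
    rw [← hval, h.left_inv hy']
  rw [← mdifferentiableAt_subtypeVal_comp_iff, hev.mdifferentiableAt_iff, mdifferentiableAt_subtype_iff]
  exact hsymm

end IsMorphism

/-- **Every morphism of `HolRS` is a morphism of Aut-holomorphic spaces** (Def 2.1 (ii)): a holomorphic
finite étale `φ : 𝕏 → 𝕐` is a local homeomorphism which, along every induced homeomorphism `U ≅ V` of
connected opens, carries `Aut^hol(U)` onto `Aut^hol(V)` — so `HolRS` is a subcategory of print's `TH`
(Rmk 2.1.1: Riemann surfaces as Aut-holomorphic orbispaces, abc-iut-L4-t2's `AutHolStructure.ofCharted`).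
[cite: MochizukiAbsTopIII2015, Definition 2.1 (ii) p.51] -/
theorem Hom.isMorphism {X Y : HolRS} (f : X ⟶ Y) :
    IsMorphism (AutHolStructure.ofCharted X.carrier) (AutHolStructure.ofCharted Y.carrier) f.toFun where
  isLocalHomeomorph := f.isLocalHomeomorph
  map_aut_eq := by
    intro U V _ _ e he
    rw [AutHolStructure.ofCharted_aut, AutHolStructure.ofCharted_aut]
    exact holAut_map_homeoConj_of_mdifferentiable e
      (mdifferentiable_opens_of_val_eq' f.mdifferentiable e he)
      (mdifferentiable_symm_of_val_eq f.mdifferentiable f.isLocalHomeomorph e he)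

/-- The Aut-holomorphic orbispace (trivial orbi-group) presented by an object of `HolRS`
(abc-iut-L4-t2's `AutHolOrbiPresentation.ofSpace`). [cite: MochizukiAbsTopIII2015, Remark 2.1.1 p.52] -/
def toPresentation (X : HolRS) : AutHolOrbiPresentation.{0} := AutHolOrbiPresentation.ofSpace X.carrier

/-- Its Aut-holomorphic structure is `AutHolStructure.ofCharted` of the carrier. [cite: MochizukiAbsTopIII2015, Remark 2.1.1 p.52] -/
theorem toPresentation_str (X : HolRS) : X.toPresentation.str = AutHolStructure.ofCharted X.carrier := rfl

/-! ### Objects: the complex plane and its connected open subsets -/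

/-- The complex plane `ℂ` as a connected Riemann surface (an object of `TH`; the universal covering of
every elliptic curve). [cite: MochizukiAbsTopIII2015, Definition 2.1 (i) p.50] -/
def complexPlane : HolRS := ⟨ℂ⟩

/-- A connected open subset `U ⊆ ℂ` as a connected Riemann surface (e.g. the unit disc, the universal
covering of every hyperbolic Riemann surface; the carriers of the germ model of Prop 2.6).
[cite: MochizukiAbsTopIII2015, Definition 2.1 (i) p.50] -/
def ofOpen (U : Opens ℂ) (hU : IsConnected (U : Set ℂ)) : HolRS :=
  haveI : ConnectedSpace U := isConnected_iff_connectedSpace.1 hU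
  ⟨U⟩


/-! ### The geometric instance of the interface `AutHolFieldFunctor` -/

/-- **Def 4.1 (i)/(iii) + Cor 2.7 (e) at the holomorphic geometric model**: the interface datum
`AutHolFieldFunctor` with `EA :=` the full subcategory of connected Riemann surfaces / holomorphic finite
étale maps cut out by the object property `Q` (print: "the elliptically admissible hyperbolic orbicurves
over CAF's" — a parameter here), "`𝒜_𝕏 := 𝒜_𝕏 ∪ {0}` … identified [… independent of '`p`'] via the various
isomorphisms '`𝒜_p ⥲ 𝒜_{p'}`' of Corollary 2.7, (e)" `:= ℂ`, the multiplier field of the germ model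
(`germAutIsoUnits p : ℂˣ ≃ₜ* 𝒜_p`), and the induced isomorphism along a holomorphic finite étale `φ` the
identity of `ℂ` (the multiplier is invariant under holomorphic changes of coordinates,
`hasDerivAt_conj_mulAffine`) — functorial trivially.
[cite: MochizukiAbsTopIII2015, Definition 4.1 (i) p.101] -/
def geometricAutHolFieldFunctor (Q : ObjectProperty HolRS) : AutHolFieldFunctor.{0} where
  EA := Q.FullSubcategory
  A := fun _ => ℂ
  isCAF := fun _ => isCAF_complex
  Amap := fun _ => RingEquiv.refl ℂ
  continuous_Amap := fun _ => continuous_id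
  continuous_Amap_symm := fun _ => continuous_id
  Amap_id := fun _ => rfl
  Amap_comp := fun _ _ => rfl

variable (Q : ObjectProperty HolRS)

/-- `EA` of the geometric instance is the full subcategory `Q` of `HolRS`. [cite: MochizukiAbsTopIII2015, Definition 4.1 (iii) p.103] -/
theorem geometric_EA : (geometricAutHolFieldFunctor Q).EA = Q.FullSubcategory := rfl

/-- `𝒜_𝕏 = ℂ` at the geometric instance. [cite: MochizukiAbsTopIII2015, Definition 4.1 (i) p.101] -/
@[simp] theorem geometric_A (X : (geometricAutHolFieldFunctor Q).EA) :
    (geometricAutHolFieldFunctor Q).A X = ℂ := rfl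

/-- `𝒜_φ = id` at the geometric instance (holomorphic morphisms only). [cite: MochizukiAbsTopIII2015, Definition 4.1 (i) p.101] -/
@[simp] theorem geometric_Amap {X Y : (geometricAutHolFieldFunctor Q).EA} (f : X ⟶ Y) :
    (geometricAutHolFieldFunctor Q).Amap f = RingEquiv.refl ℂ := rfl

/-- **The bridge to Prop 2.6 (a) at the germ model**: for a point `p` of the complex plane (a chart value
of any object), the unit group of `𝒜_𝕏 = ℂ` IS the germ group `𝒜_p` of abc-iut-w4-d104's model, via the
canonical `ℂˣ ≃ₜ* 𝒜_p` ("isomorphisms of topological groups `ℂˣ ⥲ 𝒜_p`", Prop 2.6 (a)); these are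
compatible with the `𝒜_p ⥲ 𝒜_{p'}` (`germAutIsoUnits_trans`), which is what makes `𝒜_𝕏` "independent of
'`p`'". [cite: MochizukiAbsTopIII2015, Proposition 2.6 p.57] -/
def unitsMultiplierIso (X : (geometricAutHolFieldFunctor Q).EA) (p : ℂ) :
    ((geometricAutHolFieldFunctor Q).A X)ˣ ≃ₜ* germAut p :=
  germAutIsoUnits p

/-- `EA` of the geometric instance is nonempty as soon as `Q` admits a connected Riemann surface.
[cite: MochizukiAbsTopIII2015, Definition 4.1 (iii) p.103] -/
theorem nonempty_EA (X : HolRS) (hX : Q X) : Nonempty (geometricAutHolFieldFunctor Q).EA := ⟨⟨X, hX⟩⟩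

/-- With no restriction (`Q = ⊤`) the complex plane is an object. [cite: MochizukiAbsTopIII2015, Definition 4.1 (iii) p.103] -/
theorem nonempty_EA_top : Nonempty (geometricAutHolFieldFunctor ⊤).EA := nonempty_EA ⊤ complexPlane trivial

/-! ### Aut-holomorphic pairs over geometric structure-orbispaces -/

/-- **The `TF`-pair `(𝕏 ↶ ℂ)`** over a geometric `𝕏` with the tautological Kummer structure `κ_ℂ = id`
(Def 4.1 (i): "a [k-]Kummer structure on `𝕏_ell` [is] any isomorphism of topological fields
`κ_k : k ⥲ 𝒜_𝕏_ell`"; here `k = 𝒜_𝕏 = ℂ`) — abc-iut-L4-t10's `HolTFPair.ofEA` at the geometric instance.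
[cite: MochizukiAbsTopIII2015, Definition 4.1 (i) p.101] -/
def tfPair (X : (geometricAutHolFieldFunctor Q).EA) : HolTFPair (geometricAutHolFieldFunctor Q) :=
  (HolTFPair.ofEA (geometricAutHolFieldFunctor Q)).obj X

/-- The structure-orbispace of `(𝕏 ↶ ℂ)` is `𝕏`. [cite: MochizukiAbsTopIII2015, Definition 4.1 (i) p.101] -/
@[simp] theorem tfPair_X (X : (geometricAutHolFieldFunctor Q).EA) : (tfPair Q X).X = X := rfl

/-- **The `T`-pair `(𝕏 ↶ M_T(ℂ))`**, `T ∈ {TM, TLG, TCG}` (`𝒪_ℂ^⊳`, `ℂ^×`, `𝒪_ℂ^× = S¹`), over a geometric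
`𝕏` — abc-iut-w5-d226's `HolMonoidPair.ofEA` at the geometric instance.
[cite: MochizukiAbsTopIII2015, Definition 4.1 (i) p.102] -/
def monoidPair {T : ArchPairType} (hT : T.IsMonoidType) (X : (geometricAutHolFieldFunctor Q).EA) :
    HolMonoidPair (geometricAutHolFieldFunctor Q) T :=
  (HolMonoidPair.ofEA (geometricAutHolFieldFunctor Q) hT).obj X

/-- The arithmetic data of the geometric `TM`-pair `(𝕏 ↶ 𝒪_ℂ^⊳)` is `{z ≠ 0, ‖z‖ ≤ 1}`.
[cite: MochizukiAbsTopIII2015, Definition 4.1 (i) p.101] -/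
theorem mem_monoidPair_TM_M (X : (geometricAutHolFieldFunctor Q).EA) (z : ℂ) :
    z ∈ (monoidPair Q ArchPairType.isMonoidType_TM X).M ↔ z ≠ 0 ∧ ‖z‖ ≤ 1 := Iff.rfl

/-- `𝒞^hol_TF` and `𝒞^hol_T` over the geometric `EA` are nonempty when `Q` admits an object.
[cite: MochizukiAbsTopIII2015, Definition 4.1 (ii) p.102] -/
theorem nonempty_pairs (X : HolRS) (hX : Q X) {T : ArchPairType} (hT : T.IsMonoidType) :
    Nonempty (HolTFPair (geometricAutHolFieldFunctor Q)) ∧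
      Nonempty (HolMonoidPair (geometricAutHolFieldFunctor Q) T) :=
  ⟨⟨tfPair Q ⟨X, hX⟩⟩, ⟨monoidPair Q hT ⟨X, hX⟩⟩⟩

/-! ### The model theorems of Prop 4.2 / Cor 4.5, specialised to geometric carriers -/

/-- **Prop 4.2 (i) over geometric structure-orbispaces**: for `TF`-pairs over the geometric `EA`, "the
natural functor of Definition 4.1, (iii), induces a bijection
`Isom_{𝒞^hol_T}((𝕏 ↶ M),(𝕏* ↶ M*)) ⥲ Isom_EA(𝕏, 𝕏*)`" (abc-iut-L4-t10's `mapIso_toEA_bijective`).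
[cite: MochizukiAbsTopIII2015, Proposition 4.2 (i) p.105] -/
theorem prop_4_2_i_geometric (P P' : HolTFPair (geometricAutHolFieldFunctor Q)) :
    Function.Bijective (fun φ : P ≅ P' => (HolTFPair.toEA (geometricAutHolFieldFunctor Q)).mapIso φ) :=
  HolTFPair.mapIso_toEA_bijective P P'

/-- **Prop 4.2 (i), id-rigidity clause, over geometric structure-orbispaces**: `𝒞^hol_TF` and the
`𝒞^hol_T` (`T ∈ {TM, TLG, TCG}`) over the geometric `EA` are id-rigid as soon as `EA^hol_RS(Q)` is ("follows
immediately from the slimness assertion of Lemma 4.3" — NOT proved here: campaign-L, via Cor 2.3 (i) and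
Riemann existence). [cite: MochizukiAbsTopIII2015, Proposition 4.2 (i) p.105] -/
theorem isIdRigid_pairs_of_isIdRigid_EA (hE : IsIdRigid (geometricAutHolFieldFunctor Q).EA)
    {T : ArchPairType} (hT : T.IsMonoidType) :
    IsIdRigid (HolTFPair (geometricAutHolFieldFunctor Q)) ∧
      IsIdRigid (HolMonoidPair (geometricAutHolFieldFunctor Q) T) :=
  ⟨HolTFPair.isIdRigid_of_isIdRigid_EA _ hE, HolMonoidPair.isIdRigid_of_isIdRigid_EA hT hE⟩

/-- **Cor 4.5 (i)–(v) at the archimedean model OVER GEOMETRIC CARRIERS**: abc-iut-L4-t10's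
`AbsTopIII.cor_4_5_arch` specialised to the geometric instance — given one object `𝕏₀` of `EA^hol_RS(Q)` and
the id-rigidity of `EA^hol_RS(Q)` (⇐ Lemma 4.3; the one remaining hypothesis), `Cor_4_5` holds for the
archimedean log-Frobenius data built over connected Riemann surfaces with `𝒜_𝕏 = ℂ`.
[cite: MochizukiAbsTopIII2015, Corollary 4.5 pp.107–109] -/
theorem cor_4_5_geometric (X₀ : (geometricAutHolFieldFunctor Q).EA)
    (hE : IsIdRigid (geometricAutHolFieldFunctor Q).EA) :
    Literature.AnabelianGeometry.AbsoluteAnabelian.AbsTopIII.Cor_4_5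
      (archLogFrobeniusData (geometricAutHolFieldFunctor Q))
      (archTelecoreData (geometricAutHolFieldFunctor Q)) :=
  AbsTopIII.cor_4_5_arch (geometricAutHolFieldFunctor Q) X₀ hE

end HolRS

end Literature.AnabelianGeometry.AbsoluteAnabelian

end
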